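import Literature.Claims.NS.ClayVariants
import Literature.Analysis.FluidPDE.ClassicalSolutionRescale
import Literature.Analysis.FluidPDE.SelfSimilarProofs
import HarnessLib

/-!
# Clay (B)/(D): the period of the periodic problem may be fixed — period `L` versus Fefferman's period `1`

Reference file of the D-0090 «where NS proofs break» sweep (cell `ns-claims`), companion of
`Literature/Claims/NS/ClayVariants.lean` (same namespace; own file so that the claim skeletons
importing `ClayVariants` do not acquire the scaling closure). It lands the Δ1 bookkeeping recorded
there as "torus `ℝ³/Lℤ³`, any period `L`: EQUIVALENT to period 1 by scaling": Fefferman states (B),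
(D) for `ℤ³`-periodic data and solutions, `u°(x + eⱼ) = u°(x)`, `u(x + eⱼ, t) = u(x, t)`
[FeffermanClay2006, (8), (10) p. 2], while claimed proofs typically work on `ℝ³/2πℤ³` or
`ℝ³/Lℤ³`; "by scaling" the periodic problem with period `L` is the problem with period `1` (Tao:
"one can easily reduce to the `ν = 1` case by a simple rescaling" for the viscosity, and the torus
is fixed as `ℝ³/ℤ³` after Def. 1.1 — the side length is likewise a matter of normalisation
[Tao2013Localisation, Def. 1.1, Rem. 1.2]). The scaling is Leray's parabolic one,
`u_L(t, x) = L u(L² t, L x)`, `p_L(t, x) = L² p(L² t, L x)`, which keeps the viscosity and maps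
`L`-periodic fields to `1`-periodic ones (tree: `Literature.Analysis.FluidPDE.nsRescale`,
`nsRescalePressure`, `nsRescaleData`, and the PROVED covariance of classical solutions
`IsClassicalNSSolutionOn.nsRescale_holds`, Leray 1934 §20 [Leray1934]).

## What is proved (all `theorem`s, no named facts)

* `isNavierStokesSolution_nsRescale_zero` — the rescaling of a smooth unforced solution on
  `ℝ³ × [0,∞)` (wave-0 form) is a smooth unforced solution on `ℝ³ × [0,∞)` with the rescaled datum
  and the SAME viscosity;
* `isLatticePeriodic_smul_comp_smul`, `periodic_smul_comp_inv_smul`, `isLatticePeriodic_nsRescaleData` —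
  `x ↦ L u₀(L x)` is `ℤ³`-periodic iff `u₀` is `Lℤ³`-periodic (the two directions as used);
* **`clayPeriodic_solvable_nsRescaleData_iff`** — for `L > 0`, the unforced Clay-(B)-type problem
  (printed class: `u(·,t)` periodic) for the `ℤ³`-periodic datum `nsRescaleData L u₀` is solvable iff
  the unforced problem for `u₀` has a solution smooth on `ℝ³ × [0,∞)` with `Lℤ³`-periodic velocity
  slices; `clayPeriodicErrata_solvable_nsRescaleData_iff` — the same in the errata class (`u` and `p`
  periodic);
* **`not_clayPeriodic_regularityAt_of_period`** — an unforced smooth divergence-free `Lℤ³`-periodic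
  datum WITHOUT a global smooth solution with `Lℤ³`-periodic velocity slices, at viscosity `ν`,
  refutes `clayPeriodic.RegularityAt ν`; with `ClayVariants.navierStokesBreakdownPeriodic_of_not_regularityAt`
  this gives PRINTED (D): `navierStokesBreakdownPeriodic_of_period`. This is the «period `2π`» half
  of the `ClayDelta` of `Literature.Claims.NS.Shahmurov2026b` (its `PeriodScalingBridge`, `L = 2π`).

## References

* [FeffermanClay2006] C. L. Fefferman, Existence and smoothness of the Navier–Stokes equation, CMI
  (2000/2006): (B), (D) with (8), (10), p. 2.
* [Tao2013Localisation] T. Tao, Anal. PDE 6 (2013) 25–107, arXiv:1108.1165: Def. 1.1, Rem. 1.2.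
* [Leray1934] J. Leray, Acta Math. 63 (1934), §20 (the similarity transformation).

WHAT THIS IS NOT: not a claim about NS regularity or blow-up; not a claim about any author beyond
the typed locator.
-/

open scoped ContDiff

namespace Literature.Claims.NS.ClayVariants

open Set Literature.Analysis.FluidPDE

noncomputable section

/-! ### Parabolic rescaling of smooth unforced solutions on `ℝ³ × [0,∞)` -/

/-- **Leray's scaling on Fefferman's solution class**: if `(u, p)` is smooth on `ℝ³ × [0,∞)` and
solves (1)–(3) with viscosity `ν`, `f ≡ 0` and datum `u₀`, then for `c > 0` the rescaled pair
`(c u(c²t, cx), c² p(c²t, cx))` is smooth on `ℝ³ × [0,∞)` and solves (1)–(3) with the SAME `ν`,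
`f ≡ 0` and datum `c u₀(c x)` (the tree's `IsClassicalNSSolutionOn.nsRescale_holds` on the time set
`[0,∞)`, which `t ↦ c² t` maps onto itself). [cite: Leray1934, §20] [cite: Tao2013Localisation, Rem. 1.2] -/
theorem isNavierStokesSolution_nsRescale_zero {ν : ℝ}
    {u : ℝ → EuclideanSpace ℝ (Fin 3) → EuclideanSpace ℝ (Fin 3)}
    {u₀ : EuclideanSpace ℝ (Fin 3) → EuclideanSpace ℝ (Fin 3)} {p : ℝ → EuclideanSpace ℝ (Fin 3) → ℝ}
    (hns : IsNavierStokesSolution ν 0 u₀ u p) (hu : IsSmoothOnHalfSpace u)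
    (hp : IsSmoothOnHalfSpace p) {c : ℝ} (hc : 0 < c) :
    IsNavierStokesSolution ν 0 (nsRescaleData c u₀) (nsRescale c u) (nsRescalePressure c p) ∧
      IsSmoothOnHalfSpace (nsRescale c u) ∧ IsSmoothOnHalfSpace (nsRescalePressure c p) := by
  obtain ⟨hcl, h0⟩ := isNavierStokesSolution_and_smooth_iff.mp ⟨hns, hu, hp⟩
  have hcl' := IsClassicalNSSolutionOn.nsRescale_holds hcl hc
  have hpre : (fun t : ℝ => c ^ 2 * t) ⁻¹' Ici (0 : ℝ) = Ici 0 := by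
    ext t
    simp only [mem_preimage, mem_Ici]
    exact mul_nonneg_iff_of_pos_left (by positivity)
  rw [hpre, nsRescaleForce_zero] at hcl'
  have h0' : nsRescale c u 0 = nsRescaleData c u₀ := by
    rw [nsRescale_zero_time, h0]
  exact isNavierStokesSolution_and_smooth_iff.mpr ⟨hcl', h0'⟩

/-! ### Periodicity bookkeeping: period `L` versus period `1` -/

/-- If `v` is `Lℤ³`-periodic then `x ↦ c • v(L x)` is `ℤ³`-periodic (Fefferman's (8)/(10)).
[cite: FeffermanClay2006, (8) (10) p. 2] -/
theorem isLatticePeriodic_smul_comp_smul {F : Type*} [AddCommGroup F] [Module ℝ F]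
    {v : EuclideanSpace ℝ (Fin 3) → F} {L : ℝ}
    (hper : ∀ (j : Fin 3) (x : EuclideanSpace ℝ (Fin 3)), v (x + L • EuclideanSpace.single j 1) = v x)
    (c : ℝ) : IsLatticePeriodic (fun x => c • v (L • x)) := by
  intro j x
  show c • v (L • (x + EuclideanSpace.single j 1)) = c • v (L • x)
  rw [smul_add, hper j (L • x)]

/-- If `w` is `ℤ³`-periodic and `L ≠ 0` then `x ↦ c • w(L⁻¹ x)` is `Lℤ³`-periodic.
[cite: FeffermanClay2006, (8) (10) p. 2] -/
theorem periodic_smul_comp_inv_smul {F : Type*} [AddCommGroup F] [Module ℝ F]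
    {w : EuclideanSpace ℝ (Fin 3) → F} (hper : IsLatticePeriodic w) {L : ℝ} (hL : L ≠ 0) (c : ℝ)
    (j : Fin 3) (x : EuclideanSpace ℝ (Fin 3)) :
    c • w (L⁻¹ • (x + L • EuclideanSpace.single j 1)) = c • w (L⁻¹ • x) := by
  rw [smul_add, smul_smul, inv_mul_cancel₀ hL, one_smul, hper j (L⁻¹ • x)]

/-- The rescaled datum `nsRescaleData L u₀ = L u₀(L ·)` of an `Lℤ³`-periodic field is `ℤ³`-periodic.
[cite: FeffermanClay2006, (8) p. 2] [cite: Tao2013Localisation, Rem. 1.2] -/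
theorem isLatticePeriodic_nsRescaleData {u₀ : EuclideanSpace ℝ (Fin 3) → EuclideanSpace ℝ (Fin 3)}
    {L : ℝ}
    (hper : ∀ (j : Fin 3) (x : EuclideanSpace ℝ (Fin 3)), u₀ (x + L • EuclideanSpace.single j 1) = u₀ x) :
    IsLatticePeriodic (nsRescaleData L u₀) :=
  isLatticePeriodic_smul_comp_smul hper L

/-! ### The bridge -/

/-- **Period `L` versus period `1`, printed class.** For `L > 0`, Fefferman's unforced periodic
problem (solutions smooth on `ℝ³ × [0,∞)` with `u(·,t)` `ℤ³`-periodic, condition (10) as printed)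
for the `ℤ³`-periodic datum `L u₀(L ·)` is solvable iff the unforced problem for `u₀` has a solution
smooth on `ℝ³ × [0,∞)` with `Lℤ³`-periodic velocity slices — Leray's scaling `u ↦ L u(L²t, Lx)`
and its inverse, same viscosity. [cite: Tao2013Localisation, Rem. 1.2] [cite: Leray1934, §20]
[cite: FeffermanClay2006, (B) with (8) (10), p. 2] -/
theorem clayPeriodic_solvable_nsRescaleData_iff {L : ℝ} (hL : 0 < L) (ν : ℝ)
    (u₀ : EuclideanSpace ℝ (Fin 3) → EuclideanSpace ℝ (Fin 3)) :
    clayPeriodic.Solvable ν 0 (nsRescaleData L u₀) ↔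
      ∃ (u : ℝ → EuclideanSpace ℝ (Fin 3) → EuclideanSpace ℝ (Fin 3))
        (p : ℝ → EuclideanSpace ℝ (Fin 3) → ℝ),
        IsSmoothOnHalfSpace u ∧ IsSmoothOnHalfSpace p ∧ IsNavierStokesSolution ν 0 u₀ u p ∧
          ∀ t, 0 ≤ t → ∀ (j : Fin 3) (x : EuclideanSpace ℝ (Fin 3)),
            u t (x + L • EuclideanSpace.single j 1) = u t x := by
  constructor
  · rintro ⟨v, q, hv, hq, hns, hper⟩
    have hL' : 0 < L⁻¹ := inv_pos.mpr hL
    obtain ⟨hns', hu', hp'⟩ := isNavierStokesSolution_nsRescale_zero hns hv hq hL'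
    have hdat : nsRescaleData L⁻¹ (nsRescaleData L u₀) = u₀ := by
      rw [← nsRescaleData_mul, mul_inv_cancel₀ hL.ne', nsRescaleData_one]
    rw [hdat] at hns'
    refine ⟨nsRescale L⁻¹ v, nsRescalePressure L⁻¹ q, hu', hp', hns', fun t ht j x => ?_⟩
    simp only [nsRescale_apply]
    exact periodic_smul_comp_inv_smul (hper (L⁻¹ ^ 2 * t) (by positivity)) hL.ne' L⁻¹ j x
  · rintro ⟨u, p, hu, hp, hns, hper⟩
    obtain ⟨hns', hu', hp'⟩ := isNavierStokesSolution_nsRescale_zero hns hu hp hL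
    refine ⟨nsRescale L u, nsRescalePressure L p, hu', hp', hns', fun t ht => ?_⟩
    have hslice : nsRescale L u t = fun x => L • u (L ^ 2 * t) (L • x) := funext fun x => rfl
    rw [hslice]
    exact isLatticePeriodic_smul_comp_smul (hper (L ^ 2 * t) (by positivity)) L

/-- **Period `L` versus period `1`, CMI-errata class** (`u(·,t)` AND `p(·,t)` periodic): the same
equivalence, the pressure rescaling `p ↦ L² p(L²t, Lx)` preserving periodicity likewise.
[cite: Tao2013Localisation, Rem. 1.2] [cite: Leray1934, §20] [cite: FeffermanClay2006, (B) (D) p. 2 and errata] -/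
theorem clayPeriodicErrata_solvable_nsRescaleData_iff {L : ℝ} (hL : 0 < L) (ν : ℝ)
    (u₀ : EuclideanSpace ℝ (Fin 3) → EuclideanSpace ℝ (Fin 3)) :
    clayPeriodicErrata.Solvable ν 0 (nsRescaleData L u₀) ↔
      ∃ (u : ℝ → EuclideanSpace ℝ (Fin 3) → EuclideanSpace ℝ (Fin 3))
        (p : ℝ → EuclideanSpace ℝ (Fin 3) → ℝ),
        IsSmoothOnHalfSpace u ∧ IsSmoothOnHalfSpace p ∧ IsNavierStokesSolution ν 0 u₀ u p ∧
          ∀ t, 0 ≤ t →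
            (∀ (j : Fin 3) (x : EuclideanSpace ℝ (Fin 3)), u t (x + L • EuclideanSpace.single j 1) = u t x) ∧
              ∀ (j : Fin 3) (x : EuclideanSpace ℝ (Fin 3)), p t (x + L • EuclideanSpace.single j 1) = p t x := by
  constructor
  · rintro ⟨v, q, hv, hq, hns, hper⟩
    have hL' : 0 < L⁻¹ := inv_pos.mpr hL
    obtain ⟨hns', hu', hp'⟩ := isNavierStokesSolution_nsRescale_zero hns hv hq hL'
    have hdat : nsRescaleData L⁻¹ (nsRescaleData L u₀) = u₀ := by
      rw [← nsRescaleData_mul, mul_inv_cancel₀ hL.ne', nsRescaleData_one]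
    rw [hdat] at hns'
    refine ⟨nsRescale L⁻¹ v, nsRescalePressure L⁻¹ q, hu', hp', hns', fun t ht => ⟨fun j x => ?_, fun j x => ?_⟩⟩
    · simp only [nsRescale_apply]
      exact periodic_smul_comp_inv_smul (hper (L⁻¹ ^ 2 * t) (by positivity)).1 hL.ne' L⁻¹ j x
    · simp only [nsRescalePressure_apply, ← smul_eq_mul]
      exact periodic_smul_comp_inv_smul (hper (L⁻¹ ^ 2 * t) (by positivity)).2 hL.ne' (L⁻¹ ^ 2) j x
  · rintro ⟨u, p, hu, hp, hns, hper⟩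
    obtain ⟨hns', hu', hp'⟩ := isNavierStokesSolution_nsRescale_zero hns hu hp hL
    refine ⟨nsRescale L u, nsRescalePressure L p, hu', hp', hns', fun t ht => ⟨?_, ?_⟩⟩
    · have hslice : nsRescale L u t = fun x => L • u (L ^ 2 * t) (L • x) := funext fun x => rfl
      rw [hslice]
      exact isLatticePeriodic_smul_comp_smul (hper (L ^ 2 * t) (by positivity)).1 L
    · have hslice : nsRescalePressure L p t = fun x => (L ^ 2) • p (L ^ 2 * t) (L • x) :=
        funext fun x => rfl
      rw [hslice]
      exact isLatticePeriodic_smul_comp_smul (hper (L ^ 2 * t) (by positivity)).2 (L ^ 2)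

/-- **An unforced `Lℤ³`-periodic counterexample refutes Clay-(B)-regularity at the same viscosity.**
If some smooth divergence-free `Lℤ³`-periodic datum `u₀` (`L > 0`) admits NO solution smooth on
`ℝ³ × [0,∞)` with `f ≡ 0` and `Lℤ³`-periodic velocity slices, then `clayPeriodic.RegularityAt ν`
fails: its instance at the `ℤ³`-periodic datum `L u₀(L ·)` would rescale back.
[cite: Tao2013Localisation, Rem. 1.2] [cite: FeffermanClay2006, (B) with (8) (10), p. 2] -/
theorem not_clayPeriodic_regularityAt_of_period {L : ℝ} (hL : 0 < L) {ν : ℝ}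
    {u₀ : EuclideanSpace ℝ (Fin 3) → EuclideanSpace ℝ (Fin 3)} (hu₀ : ContDiff ℝ ∞ u₀)
    (hdiv : NSWave0.IsDivFree u₀)
    (hper : ∀ (j : Fin 3) (x : EuclideanSpace ℝ (Fin 3)), u₀ (x + L • EuclideanSpace.single j 1) = u₀ x)
    (hno : ¬ ∃ (u : ℝ → EuclideanSpace ℝ (Fin 3) → EuclideanSpace ℝ (Fin 3))
        (p : ℝ → EuclideanSpace ℝ (Fin 3) → ℝ),
        IsSmoothOnHalfSpace u ∧ IsSmoothOnHalfSpace p ∧ IsNavierStokesSolution ν 0 u₀ u p ∧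
          ∀ t, 0 ≤ t → ∀ (j : Fin 3) (x : EuclideanSpace ℝ (Fin 3)),
            u t (x + L • EuclideanSpace.single j 1) = u t x) :
    ¬ clayPeriodic.RegularityAt ν := by
  intro hreg
  have hd : ContDiff ℝ ∞ (nsRescaleData L u₀) := by
    have h : nsRescaleData L u₀ = fun x => L • u₀ (L • x) := funext fun x => rfl
    rw [h]
    exact (hu₀.comp (contDiff_const_smul L)).const_smul L
  have hdivL : NSWave0.IsDivFree (nsRescaleData L u₀) := by
    have h : nsRescaleData L u₀ = fun x => L • (fun y => u₀ (L • y)) x := funext fun x => rfl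
    rw [h]
    exact VectorCalculus.IsDivFree.const_smul
      ((hu₀.differentiable (by simp)).comp (differentiable_id.const_smul L))
      (VectorCalculus.IsDivFree.comp_smul hdiv L) L
  exact hno ((clayPeriodic_solvable_nsRescaleData_iff hL ν u₀).mp
    (hreg _ hd hdivL (isLatticePeriodic_nsRescaleData hper)))

/-- **An unforced `Lℤ³`-periodic counterexample at ONE viscosity proves printed (D)**
(`NavierStokesBreakdownPeriodic`, every viscosity, period `1` as printed): period by Leray's scaling
(`not_clayPeriodic_regularityAt_of_period`), viscosity by the time dilation
(`ClayVariants.navierStokesBreakdownPeriodic_of_not_regularityAt`). [cite: Tao2013Localisation, Rem. 1.2]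
[cite: FeffermanClay2006, (D) with (8) (10), p. 2] -/
theorem navierStokesBreakdownPeriodic_of_period {L : ℝ} (hL : 0 < L) {ν : ℝ} (hν : 0 < ν)
    {u₀ : EuclideanSpace ℝ (Fin 3) → EuclideanSpace ℝ (Fin 3)} (hu₀ : ContDiff ℝ ∞ u₀)
    (hdiv : NSWave0.IsDivFree u₀)
    (hper : ∀ (j : Fin 3) (x : EuclideanSpace ℝ (Fin 3)), u₀ (x + L • EuclideanSpace.single j 1) = u₀ x)
    (hno : ¬ ∃ (u : ℝ → EuclideanSpace ℝ (Fin 3) → EuclideanSpace ℝ (Fin 3))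
        (p : ℝ → EuclideanSpace ℝ (Fin 3) → ℝ),
        IsSmoothOnHalfSpace u ∧ IsSmoothOnHalfSpace p ∧ IsNavierStokesSolution ν 0 u₀ u p ∧
          ∀ t, 0 ≤ t → ∀ (j : Fin 3) (x : EuclideanSpace ℝ (Fin 3)),
            u t (x + L • EuclideanSpace.single j 1) = u t x) :
    Summit.NavierStokesRegularity.NavierStokesRegularity.NavierStokesBreakdownPeriodic :=
  navierStokesBreakdownPeriodic_of_not_regularityAt hν
    (not_clayPeriodic_regularityAt_of_period hL hu₀ hdiv hper hno)

end

end Literature.Claims.NS.ClayVariants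

-- WHAT THIS IS NOT: not a claim about NS regularity or blow-up; not a claim about any author beyond the typed locator.
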